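import Summits.BirchSwinnertonDyer.Rank1Residual.X11b.CastellaErratumHeegner
import Literature.NumberTheory.EllipticCurves.NonvanishingTwistsPrescribedRamification
import Literature.NumberTheory.EllipticCurves.BSDRootNumberModularityOnlyProofs
import Literature.NumberTheory.EllipticCurves.AnalyticRankModularityProofs
import HarnessLib

/-!
# X11b, route R1 — the field-supply link from Friedberg–Hoffstein, and the route ASSEMBLED

HONEST FRAMING (cell `b2b-bsdres`, verbatim): the goal of the cell is to DELETE the
COMBINATION-SHAPED residual classes for ALL analytic-rank `≤ 1` curves over `ℚ` — "full BSD
formula for every rank `≤ 1` curve in class C" assembled STRICTLY from published theorems — so that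
the rank-`≤ 1` remainder becomes exactly the CONSTRUCTION-SHAPED classes, which are TYPED
(missing-input `Prop`s), NOT attempted. This is not "finishing BSD". Sub-cell `b2b-bsdres-multr1-p1`,
research route R1 for X11b (Castella 2018 Thm. A re-proved along the author's erratum). This file
discharges the `∀`-link `hField` of `routeGoal_of_links''` (the auxiliary imaginary quadratic field
of Cas18 §5 / the erratum: `q` ramified, every other prime of `N` split, `2` split if `2 ∤ N`,
`L(E^D,1) ≠ 0`) from the PUBLISHED named fact
`friedbergHoffstein_exists_twist_ne_zero_ramifiedAt` (Friedberg–Hoffstein 1995 Thm. B in the special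
case used by Castella §5; sign via Cai–Shu–Tian 2014) and the Modularity Theorem (`exists_isNewformOf`,
for the parity `w(E) = −1 ⟸ r_an = 1`, `even_analyticRank_iff_rootNumber_eq_one_of_exists_isNewformOf`),
and states the END FORM of route R1 in this session. No `def`, nothing asserted.

* `erratumField_supply` — for `W/ℚ` globally minimal elliptic with `ord_{s=1} L(E,s) = 1` and a
  NONSPLIT multiplicative prime `q`: an erratum field `K` exists (`IsErratumField W K q`).
* `routeGoal_of_links3` — **`RouteGoal` (= `BSD(E,p)` for every rank-one pair on `ChainLocus`)
  from: the PUBLISHED named facts `hGZ` (Gross–Zagier 1986 Thm. I.7.3), `hGZK`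
  (Gross–Zagier–Kolyvagin), `hSk` (Skinner 2016 Thm. C), `hmod` (modularity, BCDT 2001), `hEx` +
  `hCST` (Cai–Shu–Tian 2014 §1 + Thm. 1.1), `hFH` (Friedberg–Hoffstein 1995 Thm. B, special case);
  the proved tree theorems; and THREE `∀`-links of Castella §5: `hA` — OPEN ∘ PUB, the display
  (5.3) ⇐ erratum Thm. 1.1 ⇐ Fouquet–Wan arXiv:2107.13726 Thm. 4.41 (THE open input); `hB` — the
  Gross–Zagier paraphrase (PUB for semistable `E`, Cas18 §5 + footnote 2; erratum's "same
  argument" otherwise); `hC` — the Tamagawa relation (PUB, elementary: Cas18 §5, CGLS 2022 (5.6)).**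
  CONDITIONAL; deletes nothing; X11b stays CONSTRUCTION-SHAPED.
-/

noncomputable section

open scoped Classical

open WeierstrassCurve NumberField Literature.NumberTheory.EllipticCurves
  Literature.NumberTheory.EllipticCurves.ModularForms
  Literature.NumberTheory.EllipticCurves.Rank1Residual
  Literature.NumberTheory.EllipticCurves.Rank1Residual.Typed


namespace Summit.BirchSwinnertonDyer.Rank1Residual.X11b

/-- **The field-supply link `hField`, from Friedberg–Hoffstein (special case) and modularity.**
For `W/ℚ` globally minimal elliptic with `ord_{s=1} L(E,s) = 1` and `q` a prime of NONSPLIT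
multiplicative reduction there is an erratum field `K` for `q` (`IsErratumField W K q`: imaginary
quadratic, `q ∣ d_K`, every other prime of `N_E` split, `2` split if `2 ∤ N_E`, `L(E^{(d_K)},1) ≠ 0`):
`r_an = 1` is odd, so `w(E) = −1` (`even_analyticRank_iff_rootNumber_eq_one_of_exists_isNewformOf`,
from the Modularity Theorem `hmod`), and the named fact
`friedbergHoffstein_exists_twist_ne_zero_ramifiedAt` (Friedberg–Hoffstein 1995 Thm. B, special case;
sign `+1` for `E^D` because `E` is nonsplit at the ramified `q`, Cai–Shu–Tian 2014 p. 2524) supplies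
`K`. Cas18 §5: "Choose an imaginary quadratic field `K = ℚ(√D)` … such that `q` is ramified in `K`;
every prime factor `ℓ ≠ q` of `N` splits in `K`; `p` splits in `K`; `L(E^D,1) ≠ 0`."
[cite: Castella2018, §5 (arXiv:1704.06608 p. 12), choice of K]
[cite: FriedbergHoffstein1995, Thm. B (special case)] -/
theorem erratumField_supply (hmod : exists_isNewformOf)
    (hFH : friedbergHoffstein_exists_twist_ne_zero_ramifiedAt)
    (W : WeierstrassCurve ℚ) [W.IsElliptic] [W.IsGloballyMinimal] (p : ℕ) [Fact p.Prime]
    (q : ℕ) [Fact q.Prime] (hr : W.analyticRank = 1) (hmq : Mult W q)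
    (hnsq : ¬ W.HasSplitMultiplicativeReductionAtPrime q) :
    ∃ (K : Type) (_ : Field K) (_ : NumberField K), IsErratumField W K q := by
  have hw : W.rootNumber = -1 := by
    rcases W.rootNumber_eq_one_or with h1 | h1
    · exfalso
      have hev : Even W.analyticRank :=
        (even_analyticRank_iff_rootNumber_eq_one_of_exists_isNewformOf W hmod).mpr h1
      rw [hr] at hev
      exact Nat.not_even_one hev
    · exact h1
  obtain ⟨K, hF, hNF, hKiq, -, hqd, hsplit, h2, hL⟩ := hFH W hw q hmq hnsq 0
  exact ⟨K, hF, hNF, hKiq, hqd, hsplit, h2, hL⟩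

/-- **Route R1, assembled (end form of this session): `RouteGoal` from published named facts,
modularity, proved tree theorems, and the three `∀`-links (A) [OPEN], (B), (C) of Castella §5.**
Inputs: `hGZ` Gross–Zagier 1986 Thm. I.7.3; `hGZK` Gross–Zagier–Kolyvagin; `hSk` Skinner 2016
Thm. C; `hmod` Modularity (`exists_isNewformOf`); `hEx`, `hCST` Cai–Shu–Tian 2014 (Heegner points /
explicit Gross–Zagier under the general Heegner condition); `hFH` Friedberg–Hoffstein 1995 Thm. B
(special case) — all PUBLISHED named facts —; `hA` the display (5.3) for every Heegner point of the
erratum field — OPEN ∘ PUB (erratum Thm. 1.1 ⇐ Fouquet–Wan Thm. 4.41; Cas18 Thms. 2.3, 3.2); `hB`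
the GZ paraphrase (PUB for semistable `E`); `hC` the Tamagawa relation (PUB, elementary). Obtained
from `routeGoal_of_links''` (`CastellaErratumHeegner.lean`) by discharging `hHeeg`'s companion
`hField` with `erratumField_supply`. The population settled is exactly `ChainLocus` (A′-hypotheses
∧ second ramified multiplicative prime), conditionally on the one open input. CONDITIONAL; deletes
nothing. [cite: Castella2018, §5 (arXiv:1704.06608 p. 12)] [cite: Castella2018Erratum, Thm. A′ (p. 1)] -/
theorem routeGoal_of_links3
    (hGZ : GrossZagier1986_thm_I_7_3) (hGZK : rank_eq_analyticRank_of_analyticRank_le_one)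
    (hSk : Skinner2016.thmC_padicValRat_bsd_rank_zero) (hmod : exists_isNewformOf)
    (hEx : CaiShuTian2014.exists_isHeegnerPoint_of_heegnerCondition)
    (hCST : CaiShuTian2014.thm11_trivialChar)
    (hFH : friedbergHoffstein_exists_twist_ne_zero_ramifiedAt)
    (hA : ∀ (W : WeierstrassCurve ℚ) [W.IsElliptic] [W.IsGloballyMinimal] [NeZero (W.conductorNorm ℤ)]
        (p : ℕ) [Fact p.Prime] (q : ℕ) [Fact q.Prime] (K : Type) [Field K] [NumberField K]
        (P : (W.baseChange K).toAffine.Point),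
        ErratumHypotheses W p → W.analyticRank = 1 → q ≠ p → Mult W q →
        ¬ W.HasSplitMultiplicativeReductionAtPrime q → ¬ p ∣ padicValInt q W.minimalDiscriminantInt →
        IsErratumField W K q → IsHeegnerPoint (W.conductorNorm ℤ) W K P → ¬ IsOfFinAddOrder P →
        Display53At W p K P)
    (hB : ∀ (W : WeierstrassCurve ℚ) [W.IsElliptic] [W.IsGloballyMinimal] [NeZero (W.conductorNorm ℤ)]
        (p : ℕ) [Fact p.Prime] (q : ℕ) [Fact q.Prime] (K : Type) [Field K] [NumberField K]
        (P : (W.baseChange K).toAffine.Point) (Wd : WeierstrassCurve ℚ) [Wd.IsElliptic]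
        [Wd.IsGloballyMinimal],
        ErratumHypotheses W p → W.analyticRank = 1 → Mult W q →
        ¬ W.HasSplitMultiplicativeReductionAtPrime q → IsErratumField W K q →
        IsHeegnerPoint (W.conductorNorm ℤ) W K P → ¬ IsOfFinAddOrder P →
        (∃ C : VariableChange ℚ, C • W.quadraticTwist (NumberField.discr K : ℚ) = Wd) →
        GZParaphraseAt W p K P Wd)
    (hC : ∀ (W : WeierstrassCurve ℚ) [W.IsElliptic] [W.IsGloballyMinimal] (p : ℕ) [Fact p.Prime]
        (q : ℕ) [Fact q.Prime] (K : Type) [Field K] [NumberField K] (Wd : WeierstrassCurve ℚ)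
        [Wd.IsElliptic] [Wd.IsGloballyMinimal],
        ErratumHypotheses W p → Mult W q → ¬ W.HasSplitMultiplicativeReductionAtPrime q →
        ¬ p ∣ padicValInt q W.minimalDiscriminantInt → IsErratumField W K q →
        (∃ C : VariableChange ℚ, C • W.quadraticTwist (NumberField.discr K : ℚ) = Wd) →
        TamagawaDescentAt W p K Wd) :
    RouteGoal :=
  routeGoal_of_links'' hGZ hGZK hSk (hasEntireLFunction_rat_of_exists_isNewformOf hmod) hEx hCST
    (fun W _ _ p _ q _ _ hr _ hmq hnsq _ ↦ erratumField_supply hmod hFH W p q hr hmq hnsq)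
    hA hB hC

end Summit.BirchSwinnertonDyer.Rank1Residual.X11b

end
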